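import Literature.NumberTheory.EllipticCurves.GreenbergVatsal2000.DatumSelmerDivisible
import HarnessLib

/-!
# Greenberg–Vatsal, *On the Iwasawa invariants of elliptic curves* (Invent. Math. 142 (2000)),
# §2 Prop. (2.5) in the form of REMARK (2.7), second paragraph (pp. 24–25) — "`D^{I_η} = 0`" in place
# of "`D` unramified" — with the divisibility consequence of the proof of Prop. (2.8) (p. 25): at
# `μ = 0` the non-primitive Greenberg-datum Selmer group `S^{Σ₀}_A(ℚ_∞)` is DIVISIBLE, for a line
# datum whose quotient has NO inertia invariants (the case of an ADDITIVE potentially ordinary prime)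

HONEST FRAMING (cell `bsd-addord`, home `run/shared/lean/pub/bsd-addord/`, seat `bsd-addord-twist`;
FULL-BSD rank-`≤ 1` programme D-0033 tranche 1a, row B2 X3-share): the seat's end-state files
(`Summits/…/Additive/X3BranchAnalyticHalfGordDescent[EndState].lean`) reduce `BSD(E,p)` on the X3 rows
of the semistable-twist locus to PUBLISHED facts and ONE displayed count `hAlgW` for
`Sel_{p^∞}(E/ℚ_∞)` at the ADDITIVE prime `p` (Greenberg–Vatsal's display (16) with (11)); the road map
for `hAlgW` (memo v2.1 §7) needs, at the twisted ("ramified ordinary line") Greenberg datum of the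
additive curve, the no-finite-submodule / divisibility statement of GV Prop. (2.5) — whose displayed
hypothesis "`D` unramified" FAILS there (inertia acts on `D` through `ω^{(p−1)/2}`) but whose printed
Remark (2.7) gives it under "`D^{I_η} = 0`". This file records that PRINTED remark as ONE named
reading-fact (`def … : Prop`, nothing asserted; D-0014/D-0026: exactly one new named fact, no
definition), the sibling of `datumSelmer_divisible_of_finite_torsionBy` (file `DatumSelmerDivisible`,
`D` unramified; its `TODO(general form)` names exactly this extension). Nothing is booked by this file.

## Citation header (held text arXiv:math/9906215 = `paper:arxiv-math_9906215`; decoded copies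
## `run/shared/lean/pub/bsd-addord/bsd-addord-twist-gv2000-decoded.txt` (cell `bsd-addord`) and
## `run/shared/lean/b2b/bsd-rank1-residual/b2b-bsdres-lit/u1/gv2000_decoded.txt`; arXiv page = chunk − 23)

* Prop. (2.5), p. 23: "Let `p` be an odd prime. Assume that `S_A(ℚ_∞)` is `Λ`-cotorsion and that
  `D` is unramified for the action of `G_{ℚ_p}`. Suppose that `Σ₀` is a subset of `Σ − {p, ∞}` which
  contains `Ram(A)`. Then `S^{Σ₀}_A(ℚ_∞)^` has no nonzero, finite `Λ`-submodules."
* **Remark (2.7), pp. 24–25**: "In proposition 2.5, it is not necessary to assume that `D` is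
  unramified for the action of `G_{ℚ_p}`. In the above proof, only two properties of `D` were
  actually used. First, that `Hom_{G_{ℚ_p}}(D[π], μ_p) = 0` … Second, that `D^{I_{η_p}}` is `O`-cofree
  … This result covers virtually all the cases we are interested in. However, we will sketch another
  approach which gives the same conclusion with slightly different hypotheses. **Assume that `A`
  satisfies the hypotheses of proposition 2.1, that `Σ₀` is nonempty, and that
  `H¹(G_{(ℚ_∞)_{η_p}}/I_{η_p}, D^{I_{η_p}}) = 0`. (Note that the last hypothesis is valid if
  `D^{I_{η_p}} = 0`.)** Then, according to remark 2.2, the following map can be assumed to be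
  surjective … Therefore, `S^{Σ₀}_M(ℚ_∞)_Γ = 0` and **the conclusion in proposition 2.5 follows
  immediately**."
* Prop. (2.1), p. 17 (its hypotheses): "Assume that `S_A(ℚ_∞)` is `Λ`-cotorsion and that
  `H⁰(ℚ_∞, A*)` is finite."; p. 26, for `A = E[p^∞]`: "By Kato's theorem, `S_A(ℚ_∞)` is
  `Λ`-cotorsion. Also, `H⁰(ℚ_∞, A*)` is finite since `A* ≅ E[p^∞]` by the Weil pairing and
  `E(ℚ_∞)_tors` is known to be finite."
* Proof of Prop. (2.8), p. 25: "Obviously, `S^{Σ₀}_A(ℚ_∞)` is `Λ`-cotorsion and has `μ`-invariant `0`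
  if and only if `S^{Σ₀}_A(ℚ_∞)[π]` is finite … Assuming this is so, `S^{Σ₀}_A(ℚ_∞)^` would be a
  finitely generated `O`-module. By Proposition (2.5) its `O`-torsion submodule is `0`, and so
  `S^{Σ₀}_A(ℚ_∞)` is `O`-divisible."; Remark (2.9), p. 25: "if `D^{I_{η_p}} = 0`, the conclusion is
  still true" (the same clause for Prop. (2.8)).
* Setting (§2 p. 16, "a more general context than we actually need"): `A = V_p/T_p`, `C` = image of a
  `G_{ℚ_p}`-invariant subspace `W_p` of dimension `d⁺`, `D = A/C`,
  `L_{η_p} = ker(H¹((ℚ_∞)_{η_p}, A) → H¹(I_{η_p}, D))`, `I_{η_p}` = the inertia subgroup of `G_{(ℚ_∞)_{η_p}}`.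

## Transcription (tree vocabulary of `DatumSelmerDivisible`; no new definition)

`E/ℚ` elliptic, `A = E[p^∞] = W.geomPrimaryTorsion p`, `p` odd, `κ : ZpExtension ℚ p` cyclotomic
(`ℚ_∞ = ℚ̄^{ker κ}`), Greenberg data `L` above `p` with `C = (L v hv).plus` divisible and
`#(C ⊓ A[p]) = p` (the image of a `G_{ℚ_p}`-line, `d⁺ = 1`), and — in place of "`D` unramified" —
**`D^{I_{η_p}} = 0`**: every `m ∈ A` whose class in `D = A/C` is fixed by `I_{η_p} = I_v ∩ Gal(ℚ̄/ℚ_∞)`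
(`inertia v ⊓ ker κ`) lies in `C`; a NONEMPTY finite `Σ₀ ∌ p` with every `v ∉ Σ₀ ∪ {p}` of good
reduction (`Σ₀ ⊇ Ram(A) − {p}`, Néron–Ogg–Shafarevich). IF `S^{Σ₀}_A(ℚ_∞)[p]` is finite (= the
hypotheses of Prop. (2.1) for `A = E[p^∞]` with `μ = 0`, pp. 25–26) THEN `S^{Σ₀}_A(ℚ_∞)`
(`datumSelmerInfty κ A L Σ₀`) is `p`-divisible. WHERE IT APPLIES (reach, not mathematics): the
twisted / ramified ordinary datum of an ADDITIVE potentially ordinary or potentially multiplicative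
prime with semistability defect `2` (`Summits/…/Additive/RamifiedOrdinaryLineQuotientInvariants`:
`(E[p^∞]/C)^{ker κ ⊓ I_v} = 0` on the X3♯/X4♯(G-ord, `e = 2`) and (M) rows), where `D` is ramified
through `ω^{(p−1)/2}`.
-- TODO(general form): GV's Remark (2.7) first route (`Hom_{G_{ℚ_p}}(D[π], μ_p) = 0` and `D^{I_{η_p}}`
-- `O`-cofree, `Σ₀` possibly empty) and the full "no nonzero finite `Λ`-submodule" conclusion for
-- `A = V_p/T_p` of any `p`-adic representation are not transcribed; only the second route's
-- divisibility consequence at `μ = 0` for `A = E[p^∞]` with `D^{I_{η_p}} = 0` and `Σ₀ ≠ ∅`.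

References: [GreenbergVatsal2000] §2 Prop. (2.1) p. 17, Remark (2.2) p. 20, Prop. (2.5) p. 23,
Remark (2.7) pp. 24–25, proof of Prop. (2.8) p. 25, Remark (2.9) p. 25, p. 26.
-/

noncomputable section

open scoped Classical AddSubgroup

open NumberField IsDedekindDomain Field
open Literature.NumberTheory.EllipticCurves Literature.NumberTheory.EllipticCurves.GreenbergSelmer
  Literature.NumberTheory.GaloisRepresentations
  Literature.NumberTheory.EllipticCurves.GreenbergVatsal2000

universe u

namespace Literature.NumberTheory.EllipticCurves.GreenbergVatsal2000

/-- **Greenberg–Vatsal 2000, Prop. (2.5) via Remark (2.7) (second route, pp. 24–25) with the proof of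
Prop. (2.8) (p. 25): at `μ = 0` the non-primitive Greenberg-datum Selmer group `S^{Σ₀}_A(ℚ_∞)` is
DIVISIBLE when the quotient `D` has no `I_{η_p}`-invariants.** Remark (2.7): "In proposition 2.5, it
is not necessary to assume that `D` is unramified … Assume that `A` satisfies the hypotheses of
proposition 2.1, that `Σ₀` is nonempty, and that `H¹(G_{(ℚ_∞)_{η_p}}/I_{η_p}, D^{I_{η_p}}) = 0`. (Note
that the last hypothesis is valid if `D^{I_{η_p}} = 0`.) Then … the conclusion in proposition 2.5
follows immediately"; p. 25: "Obviously, `S^{Σ₀}_A(ℚ_∞)` is `Λ`-cotorsion and has `μ`-invariant `0`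
if and only if `S^{Σ₀}_A(ℚ_∞)[π]` is finite … By Proposition (2.5) its `O`-torsion submodule is `0`,
and so `S^{Σ₀}_A(ℚ_∞)` is `O`-divisible"; p. 26: for `A = E[p^∞]`, `H⁰(ℚ_∞, A*)` is finite.
TRANSCRIPTION (as in `datumSelmer_divisible_of_finite_torsionBy`, the unramified sibling): `E/ℚ`
elliptic, `p ≠ 2`, `κ` the cyclotomic `ℤ_p`-extension, Greenberg data `L` above `p` whose `C = M⁺`
is divisible with `#(C ∩ A[p]) = p` (image of a `G_{ℚ_p}`-line) and whose quotient `D = A/C` has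
`D^{I_{η_p}} = 0` — every `m ∈ A` with `x • m − m ∈ C` for all `x ∈ inertia v ⊓ ker κ` lies in `C` —,
a NONEMPTY finite `Σ₀ ∌ p` off which (and off `p`) `E` has good reduction: IF `S^{Σ₀}_A(ℚ_∞)[p]` is
finite THEN `S^{Σ₀}_A(ℚ_∞)` is `p`-divisible. Named reading-fact; nothing asserted. The case of the
ramified ordinary datum of an additive potentially ordinary prime (Remark (2.9)).
[cite: GreenbergVatsal2000, §2 Remark (2.7) pp. 24–25, Prop. (2.5) p. 23, proof of Prop. (2.8) p. 25, Remark (2.9) p. 25, p. 26] -/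
def datumSelmer_divisible_of_finite_torsionBy_of_gr_inertiaInvariants_eq_zero : Prop :=
  ∀ (W : WeierstrassCurve ℚ) [W.IsElliptic] (p : ℕ) [Fact p.Prime] (_hp : p ≠ 2)
    (κ : ZpExtension ℚ p) (_hκ : κ.IsCyclotomic)
    (L : Data ℚ (W.geomPrimaryTorsion p) p)
    (_hC : ∀ (v : HeightOneSpectrum (𝓞 ℚ)) (hv : ((p : ℕ) : 𝓞 ℚ) ∈ v.asIdeal),
      (∀ c ∈ (L v hv).plus, ∃ c' ∈ (L v hv).plus, p • c' = c) ∧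
        Nat.card ↥((L v hv).plus ⊓ (↥(W.geomPrimaryTorsion p))[(p : ℤ)]) = p)
    (_hD : ∀ (v : HeightOneSpectrum (𝓞 ℚ)) (hv : ((p : ℕ) : 𝓞 ℚ) ∈ v.asIdeal),
      ∀ m : W.geomPrimaryTorsion p,
        (∀ x ∈ inertia v ⊓ κ.kerSubgroup, x • m - m ∈ (L v hv).plus) → m ∈ (L v hv).plus)
    (S₀ : Finset (HeightOneSpectrum (𝓞 ℚ))) (_hne : S₀.Nonempty)
    (_hS₀ : ∀ v ∈ S₀, ((p : ℕ) : 𝓞 ℚ) ∉ v.asIdeal)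
    (_hram : ∀ v : HeightOneSpectrum (𝓞 ℚ), v ∉ S₀ → ((p : ℕ) : 𝓞 ℚ) ∉ v.asIdeal →
      W.HasGoodReductionAt v),
    Finite ↥(datumSelmerInfty κ (W.geomPrimaryTorsion p) L (↑S₀ : Set (HeightOneSpectrum (𝓞 ℚ))) ⊓
        (subgroupH1 κ.kerSubgroup (W.geomPrimaryTorsion p))[(p : ℤ)]) →
      ∀ s ∈ datumSelmerInfty κ (W.geomPrimaryTorsion p) L (↑S₀ : Set (HeightOneSpectrum (𝓞 ℚ))),
        ∃ t ∈ datumSelmerInfty κ (W.geomPrimaryTorsion p) L (↑S₀ : Set (HeightOneSpectrum (𝓞 ℚ))),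
          p • t = s

end Literature.NumberTheory.EllipticCurves.GreenbergVatsal2000

end
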